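import Summits.AnomalousDissipation.AnomalousDissipation.Theorems.MirrorVarietyTaylorGreenLoudGalerkinStatesLine
import Summits.AnomalousDissipation.AnomalousDissipation.Theorems.MirrorVarietyTaylorGreenLoudGalerkinStatesStubCriticality
import Literature.Analysis.FunctionSpaces.TorusLinearisedFormTruncation
import Literature.Analysis.FunctionSpaces.TorusTruncationH1
import Literature.Analysis.FluidPDE.SteadyNavierStokesWeakForm

/-!
# Stub `stub_discreteInfSup` of the line `stagnation-plug-froth`
# (crux stmt-AnomalousDissipation-2987, `MirrorVariety.TaylorGreenLoudGalerkinStates`)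

**Discrete inf-sup stability of the truncated linearisation** (Brezzi–Rappaz–Raviart 1980, Part I,
Thm. 3; Girault–Raviart 1986, Ch. IV §3 — here in an elementary quantitative form).  Let `v` be a
`K`-field and suppose the linearised steady form `L = linForm ν v` has the continuous inf-sup property
on `K`-fields with constant `M`: every `K`-field `w` has a `K`-field `a` with
`‖∇w‖‖∇a‖ ≤ M·L(w, a)` and `∇a ≠ 0` if `∇w ≠ 0`.  Then for all large `N` the DISCRETE form
`L_N = linForm ν (P_N v)` (`P_N = Torus.fourierTruncate N`) has the inf-sup property on band-limited
`K`-fields with constant `2M`, with ONE threshold `N₀(v, M)` for all `w`.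

Proof (no compactness / Fredholm machinery is needed in this form).  Given a band-limited `K`-field
`w`, take the continuous witness `a₀` and TRUNCATE it: `a := P_N a₀`.
* `a` is a band-limited `K`-field: truncation keeps smoothness, divergence-freeness, zero mean, and
  `K`-symmetry — `P_N` commutes with the reflections `ρ_i` (`Torus.fourierTruncate_conj_mulVecT`:
  same Fourier coefficients, `|kR_i| = |k|`), `isKField_fourierTruncate`.
* `L(w, P_N a₀) - L(w, a₀)`: the viscous term is unchanged (`Δ P_N = P_N Δ` and `P_N` is invisible to
  the band-limited `w`); the convective terms, after moving the derivative off `P_N a₀ - a₀` by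
  antisymmetry (`v`, `w` divergence free), are `≤ (C ‖∇w‖ + D ‖w‖₂) ‖P_N a₀ - a₀‖₂` with
  `C = sup ‖v‖`, `D = sup |∇v|`, and `‖P_N a₀ - a₀‖₂ ≤ ‖∇a₀‖ / (2π√(N²+1))`, `‖w‖₂ ≤ ‖∇w‖/2π`
  (`abs_linForm_fourierTruncate_sub_le`).
* `L_N(w, a) - L(w, a)`: `≤ 2 ‖P_N v - v‖_∞ ‖w‖₂ ‖∇a‖ ≤ (T_N/π) ‖∇w‖ ‖∇a₀‖` with
  `T_N = ∑_{|k|>N} ‖v̂(k)‖ → 0` (uniform convergence of truncations of smooth fields,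
  `Torus.norm_sub_fourierTruncate_apply_le`, `tendsto_tsum_compl_norm_mFourierCoeff`).
* Hence `|L_N(w, a) - L(w, a₀)| ≤ ε_N ‖∇w‖‖∇a₀‖` with `ε_N → 0` depending on `v` only; once
  `|M| ε_N ≤ 1/2`:  `M·L_N(w, a) ≥ ‖∇w‖‖∇a₀‖ - |M| ε_N ‖∇w‖‖∇a₀‖ ≥ ½ ‖∇w‖‖∇a₀‖ ≥ ½ ‖∇w‖‖∇a‖`
  (no case split on the sign of `M`; `M = 0` forces `∇ ≡ 0` on `K`-fields and is consistent), and
  `∇w ≠ 0 ⇒ ∇a₀ ≠ 0 ⇒ L_N(w, a) ≠ 0 ⇒ ∇a ≠ 0` (a smooth field with `‖∇a‖ = 0` kills the form).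
The hypothesis `0 < ν` is not needed (the viscous term drops out exactly).

Sources: Brezzi–Rappaz–Raviart, Numer. Math. 36 (1980) 1–25 [BrezziRappazRaviart1980]; Girault–Raviart,
*Finite Element Approximation of the Navier–Stokes Equations*, Ch. IV §3 [GiraultRaviart1979]; the
general torus estimates are `Literature/Analysis/FunctionSpaces/TorusLinearisedFormTruncation.lean` and
`…/TorusTruncationH1.lean` (truncation vs. lattice symmetries, mean mode); the reflection algebra is
reused from the landed `…StubCriticality.lean` / `…StubTgForceRegular.lean`.
-/

-- `Summit.<Summit>.<Problem>` is the tree's mandated summit-side namespace (CONVENTIONS §2); for this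
-- single-conjunct summit the two coincide, so the duplicate is deliberate.
set_option linter.dupNamespace false

noncomputable section

open scoped BigOperators Topology InnerProductSpace
open Filter MeasureTheory
open Literature.Analysis.FunctionSpaces Literature.Analysis.FunctionSpaces.Torus

namespace Summit.AnomalousDissipation.AnomalousDissipation.Theorems.TaylorGreenLoudGalerkinStates.DiscreteInfSup

open Summit.AnomalousDissipation.AnomalousDissipation.Theorems.TaylorGreenLoudGalerkinStates
open Summit.AnomalousDissipation.AnomalousDissipation.Theorems.TaylorGreenLoudGalerkinStates.Negative
open Summit.AnomalousDissipation.AnomalousDissipation.Theorems.TaylorGreenLoudGalerkinStates.Criticality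

/-! ## Truncations of `K`-fields are band-limited `K`-fields -/

section Truncation

variable {u : UnitAddTorus (Fin 3) → EuclideanSpace ℝ (Fin 3)}

/-- The reflections are isometries of the frequency lattice: `|k R_i|² = |k|²`. [folklore] -/
theorem freqNormSq_vecMul_reflMat (k : Fin 3 → ℤ) (i : Fin 3) :
    freqNormSq (Matrix.vecMul k (reflMat i)) = freqNormSq k := by
  simp only [freqNormSq, vecMul_reflMat_apply]
  refine Finset.sum_congr rfl fun j _ => ?_
  split_ifs <;> push_cast <;> ring

/-- `k ↦ k R_i` preserves every frequency ball `|k|² ≤ N²`. [folklore] -/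
theorem vecMul_reflMat_mem_freqBall_iff (k : Fin 3 → ℤ) (i : Fin 3) (N : ℕ) :
    Matrix.vecMul k (reflMat i) ∈ freqBall N ↔ k ∈ freqBall N := by
  rw [mem_freqBall, mem_freqBall, freqNormSq_vecMul_reflMat]

/-- **Truncation preserves `K`-symmetry**: `P_N` commutes with each conjugation `ρ_i`
(`Torus.fourierTruncate_conj_mulVecT` with `A = M = M' = R_i`, `R_i² = 1`, `|kR_i| = |k|`). [folklore] -/
theorem isKSymm_fourierTruncate (hu : IsSmooth u) (hk : IsKSymm u) (N : ℕ) : IsKSymm (fourierTruncate N u) := by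
  rw [isKSymm_iff_refl_eq] at hk ⊢
  intro i
  have h := fourierTruncate_conj_mulVecT hu.continuous (reflMat_mul_self i) (reflMat i)
    (N := N) fun k => vecMul_reflMat_mem_freqBall_iff k i N
  have hki : (fun y => Matrix.toEuclideanCLM (n := Fin 3) (𝕜 := ℝ) ((reflMat i).map (Int.cast : ℤ → ℝ))
      (u (Torus.mulVecT (reflMat i) y))) = u := hk i
  rw [hki] at h
  exact h.symm

/-- **Truncations of `K`-fields are `K`-fields**: smooth (a trigonometric polynomial), divergence free
(transversal coefficients), mean zero (`𝓕(P_N u)(0) = û(0) = 0`) and `K`-symmetric. [folklore] -/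
theorem isKField_fourierTruncate (hu : IsKField u) (N : ℕ) : IsKField (fourierTruncate N u) := by
  obtain ⟨hs, hd, hz, hk⟩ := hu
  exact ⟨isSmooth_fourierTruncate N u, isDivFree_realTrigPoly (hd.isTransversal_mFourierCoeff hs (freqBall N)),
    hasZeroMean_fourierTruncate hs.integrable hz N, isKSymm_fourierTruncate hs hk N⟩

/-- Truncations of smooth mean-zero fields are band-limited to the punctured ball `0 < |k|² ≤ N²`. [folklore] -/
theorem isBandLimited_fourierTruncate (hs : IsSmooth u) (hz : HasZeroMean u) (N : ℕ) :
    IsBandLimited N (fourierTruncate N u) :=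
  fun _ hk => mFourierCoeff_fourierTruncate_eq_zero_of_not_mem_erase hs.integrable hz N hk

/-- A field band-limited to the punctured ball has no modes outside the ball. [folklore] -/
theorem forall_mFourierCoeff_eq_zero_of_isBandLimited {N : ℕ} (h : IsBandLimited N u) :
    ∀ k ∉ freqBall N, UnitAddTorus.mFourierCoeff (EuclideanSpace.complexify ∘ u) k = 0 :=
  fun k hk => h k fun hmem => hk (Finset.mem_of_mem_erase hmem)

end Truncation

/-! ## The linearised form: splitting, degenerate case, and the two perturbation estimates -/

section LinForm

variable {ν : ℝ} {v v' w a : UnitAddTorus (Fin 3) → EuclideanSpace ℝ (Fin 3)}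

/-- For smooth data the linearised form splits into its three integrals. [folklore] -/
theorem linForm_eq (ν : ℝ) (hv : IsSmooth v) (hw : IsSmooth w) (ha : IsSmooth a) :
    linForm ν v w a = (∫ x, ⟪w x, convect v a x⟫_ℝ) + (∫ x, ⟪v x, convect w a x⟫_ℝ) +
      ν * ∫ x, ⟪w x, laplacian a x⟫_ℝ := by
  have i1 : Integrable (fun x => ⟪w x, convect v a x⟫_ℝ) volume := (hw.inner (hv.convect ha)).integrable
  have i2 : Integrable (fun x => ⟪v x, convect w a x⟫_ℝ) volume := (hv.inner (hw.convect ha)).integrable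
  have i3 : Integrable (fun x => ν * ⟪w x, laplacian a x⟫_ℝ) volume :=
    (hw.inner ha.laplacian).integrable.const_mul ν
  have i12 : Integrable (fun x => ⟪w x, convect v a x⟫_ℝ + ⟪v x, convect w a x⟫_ℝ) volume := i1.add i2
  unfold linForm
  rw [integral_add i12 i3, integral_add i1 i2, integral_const_mul]

/-- **Degenerate tests kill the form**: if `a` is smooth with `‖∇a‖₂ = 0` then `linForm ν v w a = 0`
(`(u·∇)a = 0`, `Δa = 0`). [folklore] -/
theorem linForm_eq_zero_of_gradNormSq_eq_zero (ν : ℝ) (v w : UnitAddTorus (Fin 3) → EuclideanSpace ℝ (Fin 3))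
    (ha : IsSmooth a) (h0 : gradNormSq a = 0) : linForm ν v w a = 0 := by
  unfold linForm
  simp [convect_eq_zero_of_gradNormSq_eq_zero ha h0, laplacian_eq_zero_of_gradNormSq_eq_zero ha h0]

/-- **Truncating the test** (`v`, `w` smooth divergence free, `w` mean zero and band-limited to the
ball of radius `N`, `a` smooth; `C = sup ‖v‖`, `D = sup |∇v|`):
`|L(w, P_N a) - L(w, a)| ≤ (C + D/2π) ‖∇w‖ ‖∇a‖ / (2π √(N²+1))`. [folklore] -/
theorem abs_linForm_fourierTruncate_sub_le (ν : ℝ) (hv : IsSmooth v) (hvd : IsDivFree v) (hw : IsSmooth w)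
    (hwd : IsDivFree w) (hwz : HasZeroMean w) (ha : IsSmooth a) {C D : ℝ} (hC : 0 ≤ C) (hD : 0 ≤ D)
    (hvC : ∀ x, ‖v x‖ ≤ C) (hvD : ∀ x, Real.sqrt (∑ i, ‖partialDeriv i v x‖ ^ 2) ≤ D) {N : ℕ}
    (hband : ∀ k ∉ freqBall N, UnitAddTorus.mFourierCoeff (EuclideanSpace.complexify ∘ w) k = 0) :
    |linForm ν v w (fourierTruncate N a) - linForm ν v w a| ≤
      (C + D / (2 * Real.pi)) / (2 * Real.pi * Real.sqrt ((N : ℝ) ^ 2 + 1)) *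
        (Real.sqrt (gradNormSq w) * Real.sqrt (gradNormSq a)) := by
  have hPa : IsSmooth (fourierTruncate N a) := isSmooth_fourierTruncate N a
  rw [linForm_eq ν hv hw hPa, linForm_eq ν hv hw ha,
    integral_inner_laplacian_fourierTruncate_eq_of_band_limited (hw.memLp 2) ha hband]
  have h1 := abs_integral_inner_convect_fourierTruncate_sub_le hv hvd hw ha hC hvC N
  have h2 := abs_integral_inner_convect_fourierTruncate_sub_le' hv hw hwd ha hD hvD N
  have hP := sqrt_integral_norm_sq_le_of_hasZeroMean hw hwz
  set ρ : ℝ := Real.sqrt (gradNormSq a) / (2 * Real.pi * Real.sqrt ((N : ℝ) ^ 2 + 1)) with hρ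
  have hρ0 : 0 ≤ ρ := by positivity
  have hgw : 0 ≤ Real.sqrt (gradNormSq w) := Real.sqrt_nonneg _
  rw [show ∀ a b c a' b' : ℝ, a + b + c - (a' + b' + c) = (a - a') + (b - b') from fun _ _ _ _ _ => by ring]
  calc |((∫ x, ⟪w x, convect v (fourierTruncate N a) x⟫_ℝ) - ∫ x, ⟪w x, convect v a x⟫_ℝ) +
          ((∫ x, ⟪v x, convect w (fourierTruncate N a) x⟫_ℝ) - ∫ x, ⟪v x, convect w a x⟫_ℝ)|
      ≤ C * Real.sqrt (gradNormSq w) * ρ + D * Real.sqrt (∫ x, ‖w x‖ ^ 2) * ρ :=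
        (abs_add_le _ _).trans (add_le_add h1 h2)
    _ ≤ C * Real.sqrt (gradNormSq w) * ρ + D * (Real.sqrt (gradNormSq w) / (2 * Real.pi)) * ρ := by
        gcongr
    _ = (C + D / (2 * Real.pi)) / (2 * Real.pi * Real.sqrt ((N : ℝ) ^ 2 + 1)) *
        (Real.sqrt (gradNormSq w) * Real.sqrt (gradNormSq a)) := by
        rw [hρ]; ring

/-- **Changing the base field uniformly little** (`v`, `v'`, `w`, `a` smooth, `w` mean zero,
`‖v' - v‖_∞ ≤ T`): `|linForm ν v' w a - linForm ν v w a| ≤ (T/π) ‖∇w‖ ‖∇a‖`. [folklore] -/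
theorem abs_linForm_sub_linForm_le (ν : ℝ) (hv : IsSmooth v) (hv' : IsSmooth v') (hw : IsSmooth w)
    (hwz : HasZeroMean w) (ha : IsSmooth a) {T : ℝ} (hT : 0 ≤ T) (hvT : ∀ x, ‖v' x - v x‖ ≤ T) :
    |linForm ν v' w a - linForm ν v w a| ≤ T / Real.pi * (Real.sqrt (gradNormSq w) * Real.sqrt (gradNormSq a)) := by
  rw [linForm_eq ν hv' hw ha, linForm_eq ν hv hw ha]
  have h1 := abs_integral_inner_convect_sub_le_of_norm_sub_le hv hv' hw ha hT hvT
  have h2 := abs_integral_inner_convect_sub_le_of_norm_sub_le' hv hv' hw ha hT hvT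
  have hP := sqrt_integral_norm_sq_le_of_hasZeroMean hw hwz
  have hga : 0 ≤ Real.sqrt (gradNormSq a) := Real.sqrt_nonneg _
  rw [show ∀ a b c a' b' : ℝ, a + b + c - (a' + b' + c) = (a - a') + (b - b') from fun _ _ _ _ _ => by ring]
  calc |((∫ x, ⟪w x, convect v' a x⟫_ℝ) - ∫ x, ⟪w x, convect v a x⟫_ℝ) +
          ((∫ x, ⟪v' x, convect w a x⟫_ℝ) - ∫ x, ⟪v x, convect w a x⟫_ℝ)|
      ≤ T * (Real.sqrt (∫ x, ‖w x‖ ^ 2) * Real.sqrt (gradNormSq a)) +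
        T * (Real.sqrt (∫ x, ‖w x‖ ^ 2) * Real.sqrt (gradNormSq a)) := (abs_add_le _ _).trans (add_le_add h1 h2)
    _ ≤ T * (Real.sqrt (gradNormSq w) / (2 * Real.pi) * Real.sqrt (gradNormSq a)) +
        T * (Real.sqrt (gradNormSq w) / (2 * Real.pi) * Real.sqrt (gradNormSq a)) := by gcongr
    _ = T / Real.pi * (Real.sqrt (gradNormSq w) * Real.sqrt (gradNormSq a)) := by
        field_simp
        ring

end LinForm

/-! ## The stub -/

section Main

/-- The rate `1 / (2π √(N²+1)) → 0`. [folklore] -/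
theorem tendsto_const_div_sqrt (c : ℝ) :
    Tendsto (fun N : ℕ => c / (2 * Real.pi * Real.sqrt ((N : ℝ) ^ 2 + 1))) atTop (𝓝 0) := by
  refine tendsto_const_nhds.div_atTop ?_
  refine Tendsto.const_mul_atTop Real.two_pi_pos ?_
  refine tendsto_atTop_mono (fun N => ?_) tendsto_natCast_atTop_atTop
  calc (N : ℝ) = Real.sqrt ((N : ℝ) ^ 2) := (Real.sqrt_sq (Nat.cast_nonneg N)).symm
    _ ≤ Real.sqrt ((N : ℝ) ^ 2 + 1) := Real.sqrt_le_sqrt (by linarith)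

/-- **Stub `stub_discreteInfSup`** (Brezzi–Rappaz–Raviart 1980, Part I, Thm. 3, for the `K`-symmetric
Fourier–Galerkin scheme): a continuous inf-sup constant `M` for `linForm ν v` on `K`-fields yields, for
all large `N`, the discrete inf-sup constant `2M` for `linForm ν (P_N v)` on band-limited `K`-fields
(witness: the truncation `P_N a₀` of the continuous witness; see the module docstring). [folklore] -/
theorem stub_discreteInfSup : ∀ (ν M : ℝ) (v : UnitAddTorus (Fin 3) → EuclideanSpace ℝ (Fin 3)), 0 < ν → IsKField v → (∀ w, IsKField w → ∃ a, IsKField a ∧ Real.sqrt (gradNormSq w) * Real.sqrt (gradNormSq a) ≤ M * linForm ν v w a ∧ (0 < gradNormSq w → 0 < gradNormSq a)) → ∀ᶠ N in Filter.atTop, ∀ w, IsKField w → IsBandLimited N w → ∃ a, IsKField a ∧ IsBandLimited N a ∧ Real.sqrt (gradNormSq w) * Real.sqrt (gradNormSq a) ≤ (2 * M) * linForm ν (fourierTruncate N v) w a ∧ (0 < gradNormSq w → 0 < gradNormSq a) := by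
  intro ν M v _ hv hyp
  obtain ⟨hvs, hvd, hvz, -⟩ := hv
  obtain ⟨C, hC0, hC⟩ := exists_forall_norm_le_of_isSmooth hvs
  obtain ⟨D, hD0, hD⟩ := exists_forall_sqrt_sum_sq_le_of_isSmooth hvs
  -- the uniform truncation error of `v` and the total perturbation size `ε N`
  set T : ℕ → ℝ := fun N => ∑' k : {k // k ∉ freqBall (d := Fin 3) N},
    ‖UnitAddTorus.mFourierCoeff (EuclideanSpace.complexify ∘ v) k‖ with hT
  have hT0 : ∀ N, 0 ≤ T N := fun N => tsum_nonneg fun _ => norm_nonneg _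
  have hTv : ∀ N x, ‖fourierTruncate N v x - v x‖ ≤ T N := fun N x => by
    rw [norm_sub_rev]; exact norm_sub_fourierTruncate_apply_le hvs N x
  set ε : ℕ → ℝ := fun N => (C + D / (2 * Real.pi)) / (2 * Real.pi * Real.sqrt ((N : ℝ) ^ 2 + 1)) + T N / Real.pi
    with hε
  have hεlim : Tendsto (fun N => |M| * ε N) atTop (𝓝 0) := by
    have h1 := tendsto_const_div_sqrt (C + D / (2 * Real.pi))
    have h2 : Tendsto (fun N => T N / Real.pi) atTop (𝓝 0) := by
      simpa using (Literature.Analysis.FluidPDE.tendsto_tsum_compl_norm_mFourierCoeff hvs).div_const Real.pi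
    simpa using (h1.add h2).const_mul |M|
  have hev : ∀ᶠ N in atTop, |M| * ε N ≤ 1 / 2 :=
    hεlim.eventually (eventually_le_nhds (by norm_num : (0 : ℝ) < 1 / 2))
  refine hev.mono fun N hN w hw hwb => ?_
  obtain ⟨a₀, ha₀, hle, hpos⟩ := hyp w hw
  obtain ⟨hws, hwd, hwz, -⟩ := hw
  have ha₀s : IsSmooth a₀ := ha₀.1
  have hPa : IsSmooth (fourierTruncate N a₀) := isSmooth_fourierTruncate N a₀
  refine ⟨fourierTruncate N a₀, isKField_fourierTruncate ha₀ N, isBandLimited_fourierTruncate ha₀.1 ha₀.2.2.1 N, ?_⟩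
  -- the key estimate `|L_N(w, P_N a₀) - L(w, a₀)| ≤ ε_N ‖∇w‖ ‖∇a₀‖`
  set P : ℝ := Real.sqrt (gradNormSq w) * Real.sqrt (gradNormSq a₀) with hP
  have hP0 : 0 ≤ P := mul_nonneg (Real.sqrt_nonneg _) (Real.sqrt_nonneg _)
  have hga : Real.sqrt (gradNormSq (fourierTruncate N a₀)) ≤ Real.sqrt (gradNormSq a₀) :=
    Real.sqrt_le_sqrt (gradNormSq_fourierTruncate_le_gradNormSq ha₀s N)
  have key : |linForm ν (fourierTruncate N v) w (fourierTruncate N a₀) - linForm ν v w a₀| ≤ ε N * P := by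
    have h1 := abs_linForm_fourierTruncate_sub_le ν hvs hvd hws hwd hwz ha₀s hC0 hD0 hC hD
      (forall_mFourierCoeff_eq_zero_of_isBandLimited hwb) (N := N)
    have h2 := abs_linForm_sub_linForm_le ν hvs (isSmooth_fourierTruncate N v) hws hwz hPa (hT0 N) (hTv N)
    have h2' : |linForm ν (fourierTruncate N v) w (fourierTruncate N a₀) - linForm ν v w (fourierTruncate N a₀)| ≤
        T N / Real.pi * P :=
      h2.trans (mul_le_mul_of_nonneg_left (mul_le_mul_of_nonneg_left hga (Real.sqrt_nonneg _))
        (div_nonneg (hT0 N) Real.pi_pos.le))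
    calc |linForm ν (fourierTruncate N v) w (fourierTruncate N a₀) - linForm ν v w a₀|
        = |(linForm ν (fourierTruncate N v) w (fourierTruncate N a₀) - linForm ν v w (fourierTruncate N a₀)) +
            (linForm ν v w (fourierTruncate N a₀) - linForm ν v w a₀)| := by ring_nf
      _ ≤ T N / Real.pi * P + (C + D / (2 * Real.pi)) / (2 * Real.pi * Real.sqrt ((N : ℝ) ^ 2 + 1)) * P :=
          (abs_add_le _ _).trans (add_le_add h2' h1)
      _ = ε N * P := by rw [hε]; ring
  -- `M·L_N ≥ P - |M| ε_N P ≥ P/2`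
  have hmain : P ≤ 2 * M * linForm ν (fourierTruncate N v) w (fourierTruncate N a₀) := by
    have hlow : -(|M| * (ε N * P)) ≤
        M * (linForm ν (fourierTruncate N v) w (fourierTruncate N a₀) - linForm ν v w a₀) := by
      rw [neg_le]
      calc -(M * (linForm ν (fourierTruncate N v) w (fourierTruncate N a₀) - linForm ν v w a₀))
          ≤ |M * (linForm ν (fourierTruncate N v) w (fourierTruncate N a₀) - linForm ν v w a₀)| := neg_le_abs _
        _ = |M| * |linForm ν (fourierTruncate N v) w (fourierTruncate N a₀) - linForm ν v w a₀| := abs_mul _ _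
        _ ≤ |M| * (ε N * P) := mul_le_mul_of_nonneg_left key (abs_nonneg M)
    have hMε : |M| * (ε N * P) ≤ P / 2 := by
      calc |M| * (ε N * P) = (|M| * ε N) * P := by ring
        _ ≤ (1 / 2) * P := mul_le_mul_of_nonneg_right hN hP0
        _ = P / 2 := by ring
    nlinarith [hle, hlow, hMε]
  refine ⟨?_, fun hgw => ?_⟩
  · calc Real.sqrt (gradNormSq w) * Real.sqrt (gradNormSq (fourierTruncate N a₀)) ≤ P :=
          mul_le_mul_of_nonneg_left hga (Real.sqrt_nonneg _)
      _ ≤ 2 * M * linForm ν (fourierTruncate N v) w (fourierTruncate N a₀) := hmain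
      _ = (2 * M) * linForm ν (fourierTruncate N v) w (fourierTruncate N a₀) := by ring
  · have hPpos : 0 < P := mul_pos (Real.sqrt_pos.2 hgw) (Real.sqrt_pos.2 (hpos hgw))
    refine (gradNormSq_nonneg _).lt_of_ne fun h0 => ?_
    have hL0 := linForm_eq_zero_of_gradNormSq_eq_zero ν (fourierTruncate N v) w hPa h0.symm
    rw [hL0, mul_zero] at hmain
    linarith

end Main

end Summit.AnomalousDissipation.AnomalousDissipation.Theorems.TaylorGreenLoudGalerkinStates.DiscreteInfSup

end
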